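import Summits.ResolutionOfSingularities.ResolutionOfSingularities.Theorems.FrobeniusLadderFRationalResolutionFRationalCM
import Summits.ResolutionOfSingularities.ResolutionOfSingularities.Theorems.FrobeniusLadderFRationalResolutionSopExtension
import Summits.ResolutionOfSingularities.ResolutionOfSingularities.Theorems.FrobeniusLadderFRationalResolutionPrimeAdaptedParameters
import Literature.AlgebraicGeometry.Resolution.NeronPopescuOgoma
import Mathlib.RingTheory.Ideal.Height
import Mathlib.RingTheory.Ideal.MinimalPrime.Noetherian
import HarnessLib

/-!
# Frobenius powers of height-unmixed partial parameter ideals are unmixed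
(crux `FrobeniusLadder.FRationalResolution`, line `Sketch`)

Stub `mem_span_pow_of_mul_mem` (worker W10-LOC3) of the skeleton `Sketch` for crux
stmt-ResolutionOfSingularities-15317, theme LOC (F-rationality localizes,
[HochsterHuneke1994, Thm. 4.2 (f)]).  Let `S` be a regular local ring of prime characteristic `p`,
`Q` a prime ideal, and suppose `R = S/Q` satisfies the route's inline F-rational clause (ideals
generated by systems of parameters are tightly closed).  Let `x : Fin h → R` generate an ideal all
of whose minimal primes have height `h`, let `v` lie outside all these minimal primes, and let
`q = p ^ e`.  Then `v·w ∈ (x₁^q, …, x_h^q)` forces `w ∈ (x₁^q, …, x_h^q)`.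

Proof.  Units cancel, and `(x) = R` forces `(x^q) = R`; so assume `v ∈ 𝔪` and `(x) ≠ R`.  The
family `a := (x₁^q, …, x_h^q, v)` is height-unmixed of height `h + 1` (a minimal prime of `(a)`
contains every `xᵢ`, hence strictly contains a minimal prime of `(x)`, of height `h`; Krull's height
theorem bounds it by `h + 1`) and proper, so `h + 1 ≤ dim R` and `a` extends to a system of
parameters `s = (a, t)` (`exists_isSystemOfParameters_append_of_height`).  By F-rational ⇒
Cohen–Macaulay (`isWeaklyRegular_of_fRational_clause_quotient`, [HochsterHuneke1994, Thm. 4.2 (c)])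
`s` is a weakly regular sequence, so `v` is a non-zero-divisor on `R/(x₁^q, …, x_h^q)`.
-/

-- single-problem summit: the doubled namespace component is forced
set_option linter.dupNamespace false

noncomputable section

open IsLocalRing Literature.RingTheory.TightClosure Literature.AlgebraicGeometry.Resolution

namespace Summit.ResolutionOfSingularities.ResolutionOfSingularities.Theorems.FRationalResolution

/-- STUB (worker W10-LOC3) — **FROBENIUS POWERS OF HEIGHT-UNMIXED PARTIAL PARAMETER IDEALS ARE
UNMIXED.**  For `R = S/Q` (`S` regular local of characteristic `p`, `Q` prime) satisfying the inline
F-rational clause, a family `x : Fin h → R` all of whose minimal primes have height `h`, an element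
`v` off all these minimal primes and `q = p ^ e`: `v·w ∈ (x₁^q, …, x_h^q) ⇒ w ∈ (x₁^q, …, x_h^q)`
(extend `(x^q, v)` to a system of parameters, which is a regular sequence by F-rational ⇒
Cohen–Macaulay). [HochsterHuneke1994, Thm. 4.2 (c), (f)] -/
theorem mem_span_pow_of_mul_mem (p : ℕ) [Fact p.Prime] (S : Type) [CommRing S]
    [IsRegularLocalRing S] [CharP S p] (Q : Ideal S) [Q.IsPrime]
    (hFR : ∀ d : ℕ, ringKrullDim (S ⧸ Q) = d → ∀ s : Fin d → S ⧸ Q,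
      (Ideal.span (Set.range s)).radical.IsMaximal → ∀ y c : S ⧸ Q, c ≠ 0 →
      (∀ e : ℕ, c * y ^ p ^ e ∈ Ideal.span ((fun z : S ⧸ Q => z ^ p ^ e) ''
        (Ideal.span (Set.range s) : Set (S ⧸ Q)))) → y ∈ Ideal.span (Set.range s))
    {h : ℕ} (x : Fin h → S ⧸ Q)
    (hQ : ∀ Q' ∈ (Ideal.span (Set.range x)).minimalPrimes, Q'.height = h)
    (v : S ⧸ Q) (hv : ∀ Q' ∈ (Ideal.span (Set.range x)).minimalPrimes, v ∉ Q') (e : ℕ) (w : S ⧸ Q)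
    (hw : v * w ∈ Ideal.span (Set.range fun i => x i ^ p ^ e)) :
    w ∈ Ideal.span (Set.range fun i => x i ^ p ^ e) := by
  classical
  -- the quotient `R = S/Q`: a Noetherian local domain
  haveI : IsDomain S := isDomain_of_isRegularLocalRing S
  have hQtop : Q ≠ ⊤ := ‹Q.IsPrime›.ne_top
  haveI : Nontrivial (S ⧸ Q) := Ideal.Quotient.nontrivial_iff.mpr hQtop
  haveI : IsDomain (S ⧸ Q) := Ideal.Quotient.isDomain Q
  haveI : IsLocalRing (S ⧸ Q) :=
    IsLocalRing.of_surjective' (Ideal.Quotient.mk Q) Ideal.Quotient.mk_surjective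
  have hpe : 0 < p ^ e := pow_pos (Nat.Prime.pos Fact.out) e
  set xq : Fin h → S ⧸ Q := fun i => x i ^ p ^ e with hxq
  -- (0) units cancel
  by_cases hvu : IsUnit v
  · have h1 : w = ↑hvu.unit⁻¹ * (v * w) := by rw [← mul_assoc, IsUnit.val_inv_mul, one_mul]
    rw [h1]
    exact Ideal.mul_mem_left _ _ hw
  have hvm : v ∈ maximalIdeal (S ⧸ Q) := hvu
  -- (1) `(x) = R` forces `(x^q) = R`
  by_cases hI : Ideal.span (Set.range x) = ⊤
  · have h1 : Ideal.span (Set.range xq) = ⊤ := by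
      rw [← Ideal.radical_eq_top, eq_top_iff, ← hI, Ideal.span_le]
      rintro _ ⟨i, rfl⟩
      exact ⟨p ^ e, Ideal.subset_span ⟨i, rfl⟩⟩
    rw [h1]
    exact Submodule.mem_top
  have hIm : Ideal.span (Set.range x) ≤ maximalIdeal (S ⧸ Q) := le_maximalIdeal hI
  -- (3) the family `a = (x^q, v)` is proper and height-unmixed of height `h + 1`
  set a : Fin (h + 1) → S ⧸ Q := Fin.snoc xq v with ha_def
  have hra : Set.range a = insert v (Set.range xq) := Fin.range_snoc _ _
  have ha : ∀ Q' ∈ (Ideal.span (Set.range a)).minimalPrimes, Q'.height = (h + 1 : ℕ) := by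
    intro Q' hQ'
    refine le_antisymm (height_le_of_mem_minimalPrimes_span_range _ hQ') ?_
    have hQ'p := hQ'.1.1
    rw [hra] at hQ'
    have hvQ' : v ∈ Q' := hQ'.1.2 (Ideal.subset_span (Set.mem_insert _ _))
    have hIQ' : Ideal.span (Set.range x) ≤ Q' := by
      rw [Ideal.span_le]
      rintro _ ⟨i, rfl⟩
      exact hQ'p.mem_of_pow_mem (p ^ e)
        (hQ'.1.2 (Ideal.subset_span (Set.mem_insert_of_mem _ ⟨i, rfl⟩)))
    obtain ⟨Q₀, hQ₀, hQ₀Q'⟩ := Ideal.exists_minimalPrimes_le hIQ'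
    have := hQ₀.1.1
    have hlt : Q₀ < Q' := lt_of_le_of_ne hQ₀Q' fun h' => hv Q₀ hQ₀ (h' ▸ hvQ')
    have h1 := Ideal.height_strict_mono_of_isPrime hlt
    rw [hQ Q₀ hQ₀] at h1
    push_cast
    exact Order.add_one_le_of_lt h1
  have ha' : Ideal.span (Set.range a) ≠ ⊤ := by
    refine ne_top_of_le_ne_top (maximalIdeal.isMaximal (S ⧸ Q)).ne_top ?_
    rw [hra, Ideal.span_le]
    refine Set.insert_subset hvm ?_
    rintro _ ⟨i, rfl⟩
    exact Ideal.pow_mem_of_mem _ (hIm (Ideal.subset_span ⟨i, rfl⟩)) _ hpe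
  -- dimension bookkeeping: `h + 1 ≤ d = dim R`
  obtain ⟨d, hd⟩ := exists_ringKrullDim_eq_nat (R := S ⧸ Q)
  obtain ⟨Q₁, hQ₁⟩ := Ideal.nonempty_minimalPrimes ha'
  have := hQ₁.1.1
  have hhd : h + 1 ≤ d := by
    have h1 := Ideal.height_le_ringKrullDim_of_isPrime (I := Q₁)
    rw [ha Q₁ hQ₁, hd] at h1
    exact_mod_cast h1
  have hd' : ringKrullDim (S ⧸ Q) = ((h + 1) + (d - (h + 1)) : ℕ) := by
    rw [Nat.add_sub_cancel' hhd]
    exact hd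
  -- (4) extend `a` to a system of parameters `s = (a, t)`; (5) `s` is a weakly regular sequence
  obtain ⟨t, ht⟩ := exists_isSystemOfParameters_append_of_height (S ⧸ Q) hd' a ha ha'
  have hreg := isWeaklyRegular_of_fRational_clause_quotient p S Q hFR hd' (Fin.append a t)
    (isSystemOfParameters_iff.mp ht).2
  have hlist : List.ofFn (Fin.append a t) = List.ofFn xq ++ v :: List.ofFn t := by
    rw [List.ofFn_fin_append, ha_def, List.ofFn_succ']
    simp only [Fin.snoc_castSucc, Fin.snoc_last, List.concat_eq_append, List.append_assoc,
      List.singleton_append]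
  rw [hlist] at hreg
  have hvreg := ((RingTheory.Sequence.isWeaklyRegular_cons_iff _ _ _).mp
    ((RingTheory.Sequence.isWeaklyRegular_append_iff _ _ _).mp hreg).2).1
  have hol : Ideal.ofList (List.ofFn xq) = Ideal.span (Set.range xq) := by
    change Ideal.span {r | r ∈ List.ofFn xq} = Ideal.span (Set.range xq)
    congr 1
    ext r
    simp only [Set.mem_setOf_eq, List.mem_ofFn', Set.mem_range]
  rw [hol] at hvreg
  -- (6) conclude: `v` is a non-zero-divisor on `R/(x^q)` (`mem_of_mul_mem_of_isSMulRegular`)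
  exact mem_of_mul_mem_of_isSMulRegular hvreg hw

end Summit.ResolutionOfSingularities.ResolutionOfSingularities.Theorems.FRationalResolution

end
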